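/-
Origin: expansion seat `planner-pub-hodgecm-toy2-g8-0`, handover #2 2026-08-18T15:11:13Z (`HOME/pub-hodgecm-toy2-g8/lean/Toy2g8/Contr.lean`, md5 e98cbdbd, 233 lines);
landed by the gen-8 packager in gate run 31 as `HodgeCM/Model/Toy/Contr.lean` (verbatim).
-/
/-
Origin: CONSISTENCY seat 2 gen 8 `planner-pub-hodgecm-toy2-g8-0` (unit `pub-hodgecm-toy2-g8`), WIP
`HOME/pub-hodgecm-toy2-g8/lean/Toy2g8/Contr.lean`; intended target `HodgeCM/Model/Toy/Contr.lean` (new leaf).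
-/
import Mathlib
import Summits.HodgeConjecture.HodgeCM.Model.ToyG2.GysinMap

/-!
# Exterior powers of subspaces under the block contraction

For a subspace `N ≤ V` let `⋀ᵐ_N ≤ ⋀ᵐ V` (`extPow N m`) be the span of the pure wedges of vectors of `N`
(= the range of `⋀ᵐ` of the inclusion).  For the block contraction
`contr k d ψ₁ ψ₂ τ : ⋀^{k+d} V → ⋀^k W₁` of `HodgeCM.Model.ToyG2.GysinMap` (`ψ₁ : V → W₁`, `ψ₂ : V → W₂`,
`τ` a functional on `⋀^d W₂`) we prove, with `N₀ = N ∩ ker ψ₂`: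

* `map_contr_extPow_le` — if `dim W₂ ≤ d` then `contr (⋀^{k+d}_N) ⊆ ⋀^k_{ψ₁ N₀}`;
* `map_contr_extPow_eq_bot` — if `dim N < dim N₀ + d` then `contr (⋀^{k+d}_N) = 0`.

(Expand a pure wedge of vectors from a basis of `N` adapted to `N₀ ⊕ C = N`; in each shuffle term the `d` fibre
slots must carry distinct vectors of `C ↪ W₂`, so there are none if `dim C < d`, and if `dim C ≤ d` the `k` base
slots carry vectors of `N₀`.)  This is the linear algebra behind the Gysin descent (F7d-B) of the sub-Hodge-structure
family of `HodgeCM.Model.Toy.HsMod`.  All proofs kernel-checked; nothing is cited.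
-/

noncomputable section

namespace HodgeCM.ToyG2

namespace BlockGysin

open scoped TensorProduct
open exteriorPower Module

section ExtPow

variable {K : Type*} [Field K] {V V' : Type*} [AddCommGroup V] [Module K V] [AddCommGroup V'] [Module K V']

/-- `⋀ᵐ_N ≤ ⋀ᵐ V`: the span of the pure wedges of vectors of the subspace `N` -/
def extPow (N : Submodule K V) (m : ℕ) : Submodule K (⋀[K]^m V) :=
  LinearMap.range (map m N.subtype)

/-- (Ported verbatim from the HodgeCMPerL package; no docstring in the source.) -/
theorem ιMulti_mem_extPow {N : Submodule K V} {m : ℕ} (v : Fin m → V) (hv : ∀ i, v i ∈ N) :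
    ιMulti K m v ∈ extPow N m :=
  ⟨ιMulti K m fun i => (⟨v i, hv i⟩ : N), by rw [map_apply_ιMulti]; rfl⟩

/-- to bound `⋀ᵐ_N` it suffices to bound the pure wedges of vectors of `N` -/
theorem extPow_le_iff {N : Submodule K V} {m : ℕ} {P : Submodule K (⋀[K]^m V)} :
    extPow N m ≤ P ↔ ∀ v : Fin m → V, (∀ i, v i ∈ N) → ιMulti K m v ∈ P := by
  constructor
  · exact fun h v hv => h (ιMulti_mem_extPow v hv)
  · intro h
    rw [extPow, LinearMap.range_eq_map, ← ιMulti_span, Submodule.map_span_le]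
    rintro _ ⟨a, rfl⟩
    rw [map_apply_ιMulti]
    exact h _ fun i => (a i).2

/-- sharper: pure wedges of vectors from a spanning family of `N` suffice -/
theorem extPow_le_of_span {N : Submodule K V} {m : ℕ} {P : Submodule K (⋀[K]^m V)} {ι : Type*} (w : ι → N)
    (hw : Submodule.span K (Set.range w) = ⊤) (h : ∀ g : Fin m → ι, ιMulti K m (fun i => (w (g i) : V)) ∈ P) :
    extPow N m ≤ P := by
  rw [extPow, LinearMap.range_eq_map, ← ιMulti_span_of_span (R := K) (n := m) (hs := hw), Submodule.map_span_le]
  rintro _ ⟨a, ha, rfl⟩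
  have hg : ∀ p, ∃ i, w i = a p := fun p => ha ⟨p, rfl⟩
  choose g hg using hg
  have hga : a = fun p => w (g p) := funext fun p => (hg p).symm
  rw [map_apply_ιMulti, hga]
  exact h g

/-- (Ported verbatim from the HodgeCMPerL package; no docstring in the source.) -/
theorem extPow_mono {N N' : Submodule K V} (h : N ≤ N') (m : ℕ) : extPow N m ≤ extPow N' m :=
  extPow_le_iff.mpr fun v hv => ιMulti_mem_extPow v fun i => h (hv i)

/-- (Ported verbatim from the HodgeCMPerL package; no docstring in the source.) -/
@[simp] theorem extPow_top (m : ℕ) : extPow (⊤ : Submodule K V) m = ⊤ := by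
  refine top_le_iff.mp ?_
  rw [← ιMulti_span, Submodule.span_le]
  rintro _ ⟨v, rfl⟩
  exact ιMulti_mem_extPow v fun _ => Submodule.mem_top

/-- (Ported verbatim from the HodgeCMPerL package; no docstring in the source.) -/
theorem extPow_bot_of_pos {m : ℕ} (hm : 0 < m) : extPow (⊥ : Submodule K V) m = ⊥ := by
  refine (Submodule.eq_bot_iff _).mpr ?_
  refine fun x hx => (extPow_le_iff (P := ⊥)).mpr (fun v hv => ?_) hx
  rw [Submodule.mem_bot]
  exact AlternatingMap.map_coord_zero _ (⟨0, hm⟩ : Fin m) ((Submodule.mem_bot K).mp (hv _))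

/-- `⋀ᵐ φ (⋀ᵐ_N) ⊆ ⋀ᵐ_{φ N}` -/
theorem map_extPow_le (N : Submodule K V) (m : ℕ) (φ : V →ₗ[K] V') :
    (extPow N m).map (map m φ) ≤ extPow (N.map φ) m := by
  rw [Submodule.map_le_iff_le_comap]
  refine extPow_le_iff.mpr fun v hv => ?_
  rw [Submodule.mem_comap, map_apply_ιMulti]
  exact ιMulti_mem_extPow _ fun i => Submodule.mem_map_of_mem (hv i)

end ExtPow

/-! ### The block contraction on `⋀_N` -/

section Contr

variable {K : Type*} [Field K] {V W₁ W₂ : Type*} [AddCommGroup V] [Module K V]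
  [AddCommGroup W₁] [Module K W₁] [AddCommGroup W₂] [Module K W₂]
  {k d : ℕ} (ψ₁ : V →ₗ[K] W₁) (ψ₂ : V →ₗ[K] W₂) (τ : (⋀[K]^d W₂) →ₗ[K] K)

/-- **core**: for a finite-dimensional `M` mapped to `V` by `j`, with `M₀ = ker (ψ₂ ∘ j)` and `dim M ≤ dim M₀ + d`,
the contraction maps `⋀^{k+d} j (⋀^{k+d} M)` into any subspace containing the wedges `⋀^k (ψ₁ ∘ j)` of vectors of
`M₀` — and this containment is only needed when `dim M = dim M₀ + d`. -/
theorem map_contr_range_le {M : Type*} [AddCommGroup M] [Module K M] [FiniteDimensional K M] (j : M →ₗ[K] V)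
    (P : Submodule K (⋀[K]^k W₁))
    (hd : finrank K M ≤ finrank K (LinearMap.ker (ψ₂ ∘ₗ j)) + d)
    (hP : finrank K (LinearMap.ker (ψ₂ ∘ₗ j)) + d ≤ finrank K M →
      ∀ x : Fin k → M, (∀ i, x i ∈ LinearMap.ker (ψ₂ ∘ₗ j)) → ιMulti K k (fun i => ψ₁ (j (x i))) ∈ P) :
    (LinearMap.range (map (k + d) j)).map (contr k d ψ₁ ψ₂ τ) ≤ P := by
  classical
  -- an adapted spanning family: bases of `M₀` and of a complement `C`
  set M₀ : Submodule K M := LinearMap.ker (ψ₂ ∘ₗ j) with hM₀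
  obtain ⟨C, hC⟩ := M₀.exists_isCompl
  let b₀ := Module.finBasis K M₀
  let b₁ := Module.finBasis K C
  set m₀ := finrank K M₀
  set m₁ := finrank K C
  have hsum : m₀ + m₁ = finrank K M := Submodule.finrank_add_eq_of_isCompl hC
  have hm₁ : m₁ ≤ d := by omega
  let w : Fin m₀ ⊕ Fin m₁ → M := Sum.elim (fun i => (b₀ i : M)) (fun i => (b₁ i : M))
  have hw : Submodule.span K (Set.range w) = ⊤ := by
    rw [Set.Sum.elim_range, Submodule.span_union]
    have h0 : Submodule.span K (Set.range fun i => (b₀ i : M)) = M₀ := by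
      rw [show (fun i => (b₀ i : M)) = M₀.subtype ∘ b₀ from rfl, Set.range_comp, Submodule.span_image,
        b₀.span_eq, Submodule.map_top, Submodule.range_subtype]
    have h1 : Submodule.span K (Set.range fun i => (b₁ i : M)) = C := by
      rw [show (fun i => (b₁ i : M)) = C.subtype ∘ b₁ from rfl, Set.range_comp, Submodule.span_image,
        b₁.span_eq, Submodule.map_top, Submodule.range_subtype]
    rw [h0, h1]
    exact hC.sup_eq_top
  have hw0 : ∀ i : Fin m₀, ψ₂ (j (w (Sum.inl i))) = 0 := fun i => by
    show (ψ₂ ∘ₗ j) (b₀ i : M) = 0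
    exact LinearMap.mem_ker.mp (b₀ i).2
  -- reduce to pure wedges of vectors of the family, with pairwise distinct indices
  rw [LinearMap.range_eq_map, ← ιMulti_span_of_span (R := K) (n := k + d) (hs := hw), Submodule.map_span,
    Submodule.map_span_le]
  rintro _ ⟨_, ⟨a, ha, rfl⟩, rfl⟩
  have hg : ∀ p, ∃ i, w i = a p := fun p => ha ⟨p, rfl⟩
  choose g hg using hg
  have hga : a = fun p => w (g p) := funext fun p => (hg p).symm
  subst hga
  by_cases hginj : Function.Injective g
  swap
  · rw [AlternatingMap.map_eq_zero_of_not_injective (ιMulti K (k + d)) (fun p => w (g p))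
      (fun h => hginj fun p q hpq => h (congrArg w hpq : w (g p) = w (g q))), map_zero, map_zero]
    exact P.zero_mem
  -- expand the contraction over shuffles
  rw [map_apply_ιMulti, contr_ιMulti, contrAlt_apply, domCoprod_apply_eq_sum, map_sum]
  refine P.sum_mem fun σ _ => Quotient.inductionOn' σ fun σ => ?_
  rw [rid_summand_mk, Units.smul_def, ← Int.cast_smul_eq_zsmul K]
  refine P.smul_mem _ ?_
  simp only [Function.comp_apply]
  -- the index map of this shuffle
  let G : Fin k ⊕ Fin d → Fin m₀ ⊕ Fin m₁ := fun u => g (finSumFinEquiv (σ u))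
  have hG : Function.Injective G := fun u u' h => by
    have := hginj h
    simpa using this
  by_cases hA : ∃ jj i₀, G (Sum.inr jj) = Sum.inl i₀
  · -- a fibre slot carries a vector of `M₀ = ker (ψ₂ ∘ j)`: the fibre wedge vanishes
    obtain ⟨jj, i₀, hji⟩ := hA
    have h0 : ιMulti K d (fun jj => ψ₂ (j (w (g (finSumFinEquiv (σ (Sum.inr jj))))))) = 0 := by
      refine AlternatingMap.map_coord_zero _ jj ?_
      show ψ₂ (j (w (G (Sum.inr jj)))) = 0
      rw [hji]
      exact hw0 i₀
    rw [h0, map_zero, zero_smul]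
    exact P.zero_mem
  -- all fibre slots carry complement vectors, with distinct indices: so `d ≤ m₁`, hence `m₁ = d`
  push Not at hA
  have hB : ∀ jj, ∃ x, G (Sum.inr jj) = Sum.inr x := fun jj => by
    cases hGj : G (Sum.inr jj) with
    | inl i₀ => exact absurd hGj (hA jj i₀)
    | inr x => exact ⟨x, rfl⟩
  choose c hc using hB
  have hcinj : Function.Injective c := fun j₁ j₂ h =>
    Sum.inr_injective (hG ((hc j₁).trans ((congrArg Sum.inr h).trans (hc j₂).symm)))
  have hdm : d ≤ m₁ := by simpa using Fintype.card_le_of_injective c hcinj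
  have hcsurj : Function.Surjective c :=
    ((Fintype.bijective_iff_injective_and_card c).mpr ⟨hcinj, by simp; omega⟩).2
  -- … and the base slots carry vectors of `M₀`
  have hE : ∀ i, ∃ y, G (Sum.inl i) = Sum.inl y := fun i => by
    cases hGi : G (Sum.inl i) with
    | inl y => exact ⟨y, rfl⟩
    | inr x =>
        exfalso
        obtain ⟨jj, rfl⟩ := hcsurj x
        exact Sum.inl_ne_inr (hG (hGi.trans (hc jj).symm))
  choose e he using hE
  have hfun : (fun i => ψ₁ (j (w (g (finSumFinEquiv (σ (Sum.inl i)))))))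
      = fun i => ψ₁ (j ((b₀ (e i) : M₀) : M)) := by
    funext i
    show ψ₁ (j (w (G (Sum.inl i)))) = _
    rw [he i]
    rfl
  rw [hfun]
  exact P.smul_mem _ (hP (by omega) _ fun i => (b₀ (e i)).2)

/-- **the contraction lowers `⋀_N` to `⋀_{ψ₁(N ∩ ker ψ₂)}`** when `dim W₂ ≤ d` -/
theorem map_contr_extPow_le [FiniteDimensional K V] [FiniteDimensional K W₂] (N : Submodule K V)
    (hW : finrank K W₂ ≤ d) :
    (extPow N (k + d)).map (contr k d ψ₁ ψ₂ τ) ≤ extPow ((N ⊓ LinearMap.ker ψ₂).map ψ₁) k := by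
  refine map_contr_range_le ψ₁ ψ₂ τ N.subtype _ ?_ ?_
  · have h := LinearMap.finrank_range_add_finrank_ker (ψ₂ ∘ₗ N.subtype)
    have h2 : finrank K (LinearMap.range (ψ₂ ∘ₗ N.subtype)) ≤ finrank K W₂ := Submodule.finrank_le _
    omega
  · intro _ x hx
    exact ιMulti_mem_extPow _ fun i =>
      Submodule.mem_map_of_mem (Submodule.mem_inf.mpr ⟨(x i).2, LinearMap.mem_ker.mp (hx i)⟩)

/-- the kernel of `ψ₂` on `N` is `N ∩ ker ψ₂` -/
theorem finrank_ker_comp_subtype [FiniteDimensional K V] (N : Submodule K V) :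
    finrank K (LinearMap.ker (ψ₂ ∘ₗ N.subtype)) = finrank K ↥(N ⊓ LinearMap.ker ψ₂) := by
  have hk : LinearMap.ker (ψ₂ ∘ₗ N.subtype) = Submodule.comap N.subtype (N ⊓ LinearMap.ker ψ₂) := by
    rw [LinearMap.ker_comp, Submodule.comap_inf, Submodule.comap_subtype_self, top_inf_eq]
  rw [hk]
  exact (Submodule.comapSubtypeEquivOfLe inf_le_left).finrank_eq

/-- **the contraction kills `⋀^{k+d}_N`** when `dim N < dim (N ∩ ker ψ₂) + d` -/
theorem map_contr_extPow_eq_bot [FiniteDimensional K V] (N : Submodule K V)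
    (h : finrank K N < finrank K ↥(N ⊓ LinearMap.ker ψ₂) + d) :
    (extPow N (k + d)).map (contr k d ψ₁ ψ₂ τ) = ⊥ := by
  have hker := finrank_ker_comp_subtype ψ₂ N
  refine le_bot_iff.mp (map_contr_range_le ψ₁ ψ₂ τ N.subtype ⊥ (by omega) fun hle => ?_)
  omega

end Contr

end BlockGysin

end HodgeCM.ToyG2

end
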